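import Summits.AtomisticToContinuum.HydrodynamicLimit.Theses.JParityClosure
import Summits.AtomisticToContinuum.HydrodynamicLimit.Theorems.SuperextensiveClosureCostTransferInequality
import Summits.AtomisticToContinuum.HydrodynamicLimit.Theorems.JParityClosureOddContactSymmetryGibbsInvariance
import Literature.Analysis.FluidPDE.HardSphereCollisionRecord
import Literature.Analysis.FluidPDE.TorusPairReflection
import Literature.MathematicalPhysics.KineticTheory.HardSphereCampbellAssembly
import Literature.MathematicalPhysics.KineticTheory.HardSphereEulerProofs
import Literature.MathematicalPhysics.KineticTheory.MetropolisOddStatistic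
import Summits.AtomisticToContinuum.HydrodynamicLimit.Theorems.JParityClosureOddContactSymmetrySlabShiftDecomp
import Summits.AtomisticToContinuum.HydrodynamicLimit.Theorems.JParityClosureOddContactSymmetryCollisionPairSumMeasurable
import Summits.AtomisticToContinuum.HydrodynamicLimit.Theorems.JParityClosureOddContactSymmetryMetroMarkRegular
import Summits.AtomisticToContinuum.HydrodynamicLimit.Theorems.JParityClosureOddContactSymmetryHoelderChernoff
import Summits.AtomisticToContinuum.HydrodynamicLimit.Theorems.JParityClosureOddContactSymmetryTimeZeroNull
import Summits.AtomisticToContinuum.HydrodynamicLimit.Theorems.JParityClosureOddContactSymmetryKineticSlabCentring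
import Summits.AtomisticToContinuum.HydrodynamicLimit.Theorems.JParityClosureOddContactSymmetryKineticSlabMeso
import Summits.AtomisticToContinuum.HydrodynamicLimit.Theorems.JParityClosureOddContactSymmetryFluxPairReflect
import Summits.AtomisticToContinuum.HydrodynamicLimit.Theorems.JParityClosureOddContactSymmetryFluxOddBound
import Summits.AtomisticToContinuum.HydrodynamicLimit.Theorems.JParityClosureOddContactSymmetrySlabCentringOf
import Summits.AtomisticToContinuum.HydrodynamicLimit.Theorems.JParityClosureOddContactSymmetryMaxwellDefectFlux
import HarnessLib

/-!
# Skeleton — crux `JParityClosure.OddContactSymmetry` (stmt-AtomisticToContinuum-17722, rev 5), line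
`KineticSlabSketch` (card `kinetic-slab-entropy-spending`), leads `prover-line-stmt-AtomisticToContinuum-17722-0` (cycle 1),
`prover-line-stmt-AtomisticToContinuum-17722-c1-0` (cycle 2: S1 split), `prover-line-stmt-AtomisticToContinuum-17722-c2-0`
(cycle 3: S1a reshaped into P3 `stub_fluxPairReflect` + G1 `stub_fluxOddBound` + P4 `stub_maxwellDefectFlux` + G2
`stub_slabCentring_of`, composition `slabCentring` checked here)

`OddContactSymmetry_of` concludes the crux BY NAME from the registered stubs `stub_*` (the only `sorry`s):

* S1 `slabPressure` = S1a `stub_slabCentring` (static centring, `|E_G S̃| = o(K(N+1))`) + S1b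
  `stub_slabPressureCentred` (THE BET, centred) via the LANDED glue `slabPressure_of_centring_of_centred` (p139841; reshape by lead c1, cycle 2).  S1 (equilibrium): under the flow-invariant homogeneous Gibbs law
  `G_N = localGibbsLaw σ 1 0 θe`, the Metropolis-odd collision sum over ONE kinetic slab `(0, ℓ]`,
  `K t_N/2 ≤ ℓ ≤ K t_N` (`t_N = (N+1)^{-1/3}`), read at the kinetic mesoscale `r = K^{1/4} t_N`, has
  per-particle exponential moments `∫ exp((b/K)|S̃|) dG_N ≤ exp(b y (N+1))` for every tilt `b` and level
  `y > 0` once `K ≥ K₀(b, y, …)`, uniformly over the time-shifts `χ(· + s, ·)`, `s ∈ [0, τ]`, of the weight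
  (pressure form of the card's `SlabOddRate`: rate divergence in the slab length `K`).
* S2 `stub_slabShiftDecomp` — pathwise window bookkeeping on the good set (shift along the flow,
  additivity over consecutive slabs, closed vs half-open window); general summands.
* S3 `stub_collisionPairSumMeasurable` — measurability in the initial datum of collision pair sums whose
  summand sees the current configuration (velocity-jump approximants, as in
  `EmpiricalCollisionMeasureMeasurable`); general summands.
* S3b `stub_metroMarkRegular` — the Metropolis-odd mark is continuous at contact configurations and
  measurable in the configuration (feeds S3).
* S4 `stub_hoelderChernoff` — abstract: Hölder over measure-preserving shifts + Chernoff.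
* S5 `stub_timeZeroNull` — a collision at time `0` is a null event (contact sets are Lebesgue-null).
* S6 `stub_scaleTransfer` — (2B): pre-shock two-scale consistency of the Metropolis statistic, fixed `r`
  versus the kinetic mesoscale `K^{1/4}(N+1)^{-1/3}` (the K1-strength residue every fixed-`r` line owes).

Composition: S2+S3+S3b+S4+S5+S1 ⇒ `windowRate` (full-window equilibrium large-deviation bound
`G_N{x < |D_{r_K}|} ≤ e^{-M(N+1)}` for every `M`, `K ≥ K₀(x, M)`); `windowRate` + the PROVED
`TransferInequality` (`transferInequality_proof`: `LG(S)² ≤ e^{C(N+1)} G(S)` for every set `S`) + S6 ⇒ the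
crux (union bound).  No relative-entropy bookkeeping and no measurability enter the top composition.
-/

noncomputable section

open scoped BigOperators Classical InnerProductSpace ENNReal Topology
open Set MeasureTheory Filter
open Literature.Analysis.FluidPDE Literature.MathematicalPhysics.KineticTheory
open Summit.AtomisticToContinuum.HydrodynamicLimit.Theses.JParityClosure

namespace Summit.AtomisticToContinuum.HydrodynamicLimit.Theorems.OddContactSymmetryKineticSlab

/-! ## Vocabulary

The statistic is named in `Literature/MathematicalPhysics/KineticTheory/MetropolisOddStatistic.lean` (p134645):
`metroOddMark`, `metroOddSum` (window `S`, inline form), `metroOddStat` (verbatim crux `let`-chain),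
`metroOddStat_eq` (rfl factorisation), `metroOddSum_eq_collisionPairSum_of_mem_good`, `abs_metroOddMark_le`. -/

/-- Shifting the time weight: the mark at time `t + s` with weight `χ` is the mark at time `t` with the
shifted weight `χ(· + s, ·)` (definitional: the mark sees time only through `χ`). [folklore] -/
theorem metroOddMark_add {σ : ℝ} {N : ℕ} (χ : ℝ × UnitAddTorus (Fin 3) → ℝ) (g : ℝ → ℝ)
    (Ψ : V3 × V3 × V3 → ℝ) (r ϑ t s : ℝ) (z : Config (N + 1) (Fin 3) T3) (i j : Fin (N + 1)) :
    metroOddMark σ N χ g Ψ r ϑ (t + s) z i j =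
      metroOddMark σ N (fun p => χ (p.1 + s, p.2)) g Ψ r ϑ t z i j :=
  rfl

/-! ## The crux, named -/

/-- The crux is the statement about `metroOddStat` (definitional unfolding of the route's `let`-chain). [folklore] -/
theorem oddContactSymmetry_iff_metroOddStat :
    OddContactSymmetry ↔
    ∃ η₀ : ℝ, 0 < η₀ ∧ ∀ (a₀ θ₀ : T3 → ℝ) (u₀ : T3 → V3), Continuous a₀ → Continuous θ₀ → Continuous u₀ →
      (∀ x, 0 < a₀ x) → (∀ x, 0 < θ₀ x) → ∃ σ₀ : ℝ, 0 < σ₀ ∧ ∀ σ : ℝ, 0 < σ → σ < σ₀ →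
      ∀ (T : ℝ) (ρ θ : ℝ → T3 → ℝ) (u : ℝ → T3 → V3), IsHardSphereEulerSolution σ T ρ u θ →
      ∀ Φ : (N : ℕ) → HardSphereFlow (Torus.geometry (Fin 3)) (hsDiameter σ N) (N + 1),
      TendstoHydroFieldsAt (fun N => localGibbsLaw σ a₀ u₀ θ₀ N (Φ N)) Φ ρ u θ 0 →
      ∀ τ : ℝ, 0 < τ → τ < T → ∀ χ : ℝ × UnitAddTorus (Fin 3) → ℝ, Continuous χ → ∀ g : ℝ → ℝ, Continuous g →
      (∀ a, η₀ ≤ a → g a = 0) →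
      ∀ Ψ : EuclideanSpace ℝ (Fin 3) × EuclideanSpace ℝ (Fin 3) × EuclideanSpace ℝ (Fin 3) → ℝ, Continuous Ψ →
      (∃ C : ℝ, ∀ q, |Ψ q| ≤ C) →
      (∀ (n v w : EuclideanSpace ℝ (Fin 3)), ‖n‖ = 1 →
        Ψ (-n, (reflectVel n (v, w)).1, (reflectVel n (v, w)).2) = -Ψ (n, v, w)) →
      ∀ η δ : ℝ, 0 < η → 0 < δ → ∃ r₀ : ℝ, 0 < r₀ ∧ ∀ r ϑ : ℝ, 0 < r → r < r₀ → 0 < ϑ → ϑ < r₀ →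
      ∃ N₀ : ℕ, ∀ N : ℕ, N₀ ≤ N →
        localGibbsLaw σ a₀ u₀ θ₀ N (Φ N) {z | η < |metroOddStat σ N (Φ N) τ χ g Ψ r ϑ z|} ≤ ENNReal.ofReal δ :=
  Iff.rfl

/-! ## Registered stubs

LANDED (imported): S2 `stub_slabShiftDecomp` (p135469), S3 `stub_collisionPairSumMeasurable` (p136068),
S3b `stub_metroMarkRegular` (p136674), S4 `stub_hoelderChernoff` (p136845), S5 `stub_timeZeroNull` (p137154).
LANDED also: P3 `stub_fluxPairReflect` (p164631), G1 `stub_fluxOddBound` (p164705), G2 `stub_slabCentring_of` (p165664),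
F1 `stub_fluxLeGibbs` (p164740).
S1a is CLOSED (P3 G1 G2 P4 landed).
OPEN (the only `sorry`s):
`stub_slabCentring_of` (G2); S1b `stub_slabPressureCentred` (the bet),
S6 `stub_scaleTransfer` ((2B); crux-equivalent modulo C⁺ — `oddContactSymmetry_iff_scaleTransfer_of_meso`,
Theorems/…KineticSlabMeso.lean). -/

/-! P3 `stub_fluxPairReflect` LANDED: `OddContactSymmetryKineticSlabSketch.stub_fluxPairReflect` (p164631,
`Theorems/JParityClosureOddContactSymmetryFluxPairReflect.lean`). -/

/-! P4 `stub_maxwellDefectFlux` LANDED: `stub_maxwellDefectFlux` (p169150, `Theorems/JParityClosureOddContactSymmetryMaxwellDefectFlux.lean`; pieces F1 p164740,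
F2 p165971, V1 p166477, V2 p165916, K1a p165813, K1b p165436, K1c p165960, K1d p165792, K1-tools p167353, K1 p168281, A1 p166521, A2 p166570,
vel p168063). -/

/-! G1 `stub_fluxOddBound` LANDED: `stub_fluxOddBound` (p164705, `Theorems/JParityClosureOddContactSymmetryFluxOddBound.lean`). -/

/-! G2 `stub_slabCentring_of` LANDED: `stub_slabCentring_of` (p165664, `Theorems/JParityClosureOddContactSymmetrySlabCentringOf.lean`;
tools p165024 `…SlabCentringOfTools.lean`). -/

/-- **S1a `slabCentring`** (formerly the registered stub `stub_slabCentring`; now DERIVED, lead c2 reshape):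
`slabCentring = stub_slabCentring_of (stub_fluxOddBound stub_fluxPairReflect) stub_maxwellDefectFlux`.  Under the
flow-invariant homogeneous Gibbs law the mean of the Metropolis-odd slab sum at the kinetic mesoscale is `o(K(N+1))`. [folklore] -/
theorem slabCentring :
    ∃ η₀ : ℝ, 0 < η₀ ∧ ∀ θe : ℝ, 0 < θe → ∃ σ₀ : ℝ, 0 < σ₀ ∧ ∀ σ : ℝ, 0 < σ → σ < σ₀ →
    ∀ Φ : (N : ℕ) → HardSphereFlow (Torus.geometry (Fin 3)) (hsDiameter σ N) (N + 1),
    ∀ τ : ℝ, 0 < τ → ∀ χ : ℝ × UnitAddTorus (Fin 3) → ℝ, Continuous χ →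
    ∀ g : ℝ → ℝ, Continuous g → (∀ a, η₀ ≤ a → g a = 0) →
    ∀ Ψ : V3 × V3 × V3 → ℝ, Continuous Ψ → (∃ C : ℝ, ∀ q, |Ψ q| ≤ C) →
    (∀ (n v w : V3), ‖n‖ = 1 → Ψ (-n, (reflectVel n (v, w)).1, (reflectVel n (v, w)).2) = -Ψ (n, v, w)) →
    ∀ ϑ : ℝ, 0 < ϑ → ∀ y : ℝ, 0 < y →
    ∃ K₀ : ℕ, ∀ K : ℕ, K₀ ≤ K → ∃ N₀ : ℕ, ∀ N : ℕ, N₀ ≤ N →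
    ∀ s ∈ Set.Icc (0 : ℝ) τ, ∀ ℓ : ℝ,
      (K : ℝ) * ((N + 1 : ℕ) : ℝ) ^ (-(1 / 3 : ℝ)) / 2 ≤ ℓ → ℓ ≤ (K : ℝ) * ((N + 1 : ℕ) : ℝ) ^ (-(1 / 3 : ℝ)) →
      |∫ z, metroOddSum σ N (Φ N) (Set.Ioc 0 ℓ) (fun p => χ (p.1 + s, p.2)) g Ψ
          ((K : ℝ) ^ (1 / 4 : ℝ) * ((N + 1 : ℕ) : ℝ) ^ (-(1 / 3 : ℝ))) ϑ z
        ∂(localGibbsLaw σ (fun _ => 1) (fun _ => 0) (fun _ => θe) N (Φ N))|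
      ≤ y * K * ((N : ℝ) + 1) :=
  stub_slabCentring_of (stub_fluxOddBound OddContactSymmetryKineticSlabSketch.stub_fluxPairReflect) stub_maxwellDefectFlux

/-- **S1b — THE BET `stub_slabPressureCentred` (equilibrium, one kinetic slab, pressure form, CENTRED; reshape of S1,
lead c1).**  As S1, for the centred slab sum `X − ∫ X dG_N`: for every tilt `b > 0` and level `y > 0` there is `K₀` with:
for `K ≥ K₀` and all large `N`, uniformly in `s ∈ [0, τ]`, `ℓ ∈ [K t_N/2, K t_N]`, `b' ∈ [b/2, b]`,
`∫ exp((b'/K) |X − ∫ X dG_N|) dG_N ≤ exp(b' y (N+1))` — rate divergence in `K` of the card's `SlabOddRate` for the genuinely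
fluctuating part (Gaussian regime: `Var_G X = O(K(N+1))`, no anomalous growth in `K`; beyond: no `o(K)`-cost coherent J-odd
mechanism over `K` mean free times). [conjecture] -/
theorem stub_slabPressureCentred :
    ∃ η₀ : ℝ, 0 < η₀ ∧ ∀ θe : ℝ, 0 < θe → ∃ σ₀ : ℝ, 0 < σ₀ ∧ ∀ σ : ℝ, 0 < σ → σ < σ₀ →
    ∀ Φ : (N : ℕ) → HardSphereFlow (Torus.geometry (Fin 3)) (hsDiameter σ N) (N + 1),
    ∀ τ : ℝ, 0 < τ → ∀ χ : ℝ × UnitAddTorus (Fin 3) → ℝ, Continuous χ →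
    ∀ g : ℝ → ℝ, Continuous g → (∀ a, η₀ ≤ a → g a = 0) →
    ∀ Ψ : V3 × V3 × V3 → ℝ, Continuous Ψ → (∃ C : ℝ, ∀ q, |Ψ q| ≤ C) →
    (∀ (n v w : V3), ‖n‖ = 1 → Ψ (-n, (reflectVel n (v, w)).1, (reflectVel n (v, w)).2) = -Ψ (n, v, w)) →
    ∀ ϑ : ℝ, 0 < ϑ → ∀ b y : ℝ, 0 < b → 0 < y →
    ∃ K₀ : ℕ, ∀ K : ℕ, K₀ ≤ K → ∃ N₀ : ℕ, ∀ N : ℕ, N₀ ≤ N →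
    ∀ s ∈ Set.Icc (0 : ℝ) τ, ∀ ℓ : ℝ,
      (K : ℝ) * ((N + 1 : ℕ) : ℝ) ^ (-(1 / 3 : ℝ)) / 2 ≤ ℓ → ℓ ≤ (K : ℝ) * ((N + 1 : ℕ) : ℝ) ^ (-(1 / 3 : ℝ)) →
    ∀ b' : ℝ, b / 2 ≤ b' → b' ≤ b →
      ∫⁻ z, ENNReal.ofReal (Real.exp (b' / K *
          |metroOddSum σ N (Φ N) (Set.Ioc 0 ℓ) (fun p => χ (p.1 + s, p.2)) g Ψ
              ((K : ℝ) ^ (1 / 4 : ℝ) * ((N + 1 : ℕ) : ℝ) ^ (-(1 / 3 : ℝ))) ϑ z -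
            ∫ z', metroOddSum σ N (Φ N) (Set.Ioc 0 ℓ) (fun p => χ (p.1 + s, p.2)) g Ψ
              ((K : ℝ) ^ (1 / 4 : ℝ) * ((N + 1 : ℕ) : ℝ) ^ (-(1 / 3 : ℝ))) ϑ z'
              ∂(localGibbsLaw σ (fun _ => 1) (fun _ => 0) (fun _ => θe) N (Φ N))|))
        ∂(localGibbsLaw σ (fun _ => 1) (fun _ => 0) (fun _ => θe) N (Φ N))
      ≤ ENNReal.ofReal (Real.exp (b' * y * ((N : ℝ) + 1))) := by
  sorry

/-- **S1 `slabPressure` (formerly the registered stub `stub_slabPressure`; now DERIVED from S1a + S1b by the glue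
`slabPressure_of_centring_of_centred`, LANDED p139841 `Theorems/…KineticSlabCentring.lean`).**  Under the
flow-invariant homogeneous Gibbs law, one kinetic slab, reading scale `K^{1/4} t_N`:
`∫ exp((b'/K) |S̃|) dG_N ≤ exp(b' y (N+1))` for every tilt `b`, level `y > 0`, `K ≥ K₀(b, y, …)`, uniformly over the
time-shifts, slab lengths and `b' ∈ [b/2, b]`. [folklore] -/
theorem slabPressure :
    ∃ η₀ : ℝ, 0 < η₀ ∧ ∀ θe : ℝ, 0 < θe → ∃ σ₀ : ℝ, 0 < σ₀ ∧ ∀ σ : ℝ, 0 < σ → σ < σ₀ →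
    ∀ Φ : (N : ℕ) → HardSphereFlow (Torus.geometry (Fin 3)) (hsDiameter σ N) (N + 1),
    ∀ τ : ℝ, 0 < τ → ∀ χ : ℝ × UnitAddTorus (Fin 3) → ℝ, Continuous χ →
    ∀ g : ℝ → ℝ, Continuous g → (∀ a, η₀ ≤ a → g a = 0) →
    ∀ Ψ : V3 × V3 × V3 → ℝ, Continuous Ψ → (∃ C : ℝ, ∀ q, |Ψ q| ≤ C) →
    (∀ (n v w : V3), ‖n‖ = 1 → Ψ (-n, (reflectVel n (v, w)).1, (reflectVel n (v, w)).2) = -Ψ (n, v, w)) →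
    ∀ ϑ : ℝ, 0 < ϑ → ∀ b y : ℝ, 0 < b → 0 < y →
    ∃ K₀ : ℕ, ∀ K : ℕ, K₀ ≤ K → ∃ N₀ : ℕ, ∀ N : ℕ, N₀ ≤ N →
    ∀ s ∈ Set.Icc (0 : ℝ) τ, ∀ ℓ : ℝ,
      (K : ℝ) * ((N + 1 : ℕ) : ℝ) ^ (-(1 / 3 : ℝ)) / 2 ≤ ℓ → ℓ ≤ (K : ℝ) * ((N + 1 : ℕ) : ℝ) ^ (-(1 / 3 : ℝ)) →
    ∀ b' : ℝ, b / 2 ≤ b' → b' ≤ b →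
      ∫⁻ z, ENNReal.ofReal (Real.exp (b' / K *
          |metroOddSum σ N (Φ N) (Set.Ioc 0 ℓ) (fun p => χ (p.1 + s, p.2)) g Ψ
            ((K : ℝ) ^ (1 / 4 : ℝ) * ((N + 1 : ℕ) : ℝ) ^ (-(1 / 3 : ℝ))) ϑ z|))
        ∂(localGibbsLaw σ (fun _ => 1) (fun _ => 0) (fun _ => θe) N (Φ N))
      ≤ ENNReal.ofReal (Real.exp (b' * y * ((N : ℝ) + 1))) :=
  slabPressure_of_centring_of_centred slabCentring stub_slabPressureCentred

/-- **S6 `stub_scaleTransfer` — (2B) pre-shock two-scale consistency of the Metropolis statistic.**  Under the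
crux's hypotheses (classical hs-Euler solution on `[0, T)`, flows with the `t = 0` LLN, `τ < T`), for every
continuous `χ`, cutoff `g` vanishing on `[η₀, ∞)`, bounded continuous J-odd `Ψ` and `η, δ > 0` there is `r₀`
such that for `r, ϑ < r₀` and every large slab parameter `K`, eventually in `N`, the statistic read at the
fixed scale `r` and the one read at the kinetic mesoscale `K^{1/4}(N+1)^{-1/3}` (same `ϑ`, same collisions,
same marks; only the estimator radii of `ρ_r`, `h_{r,ϑ}` differ) differ by more than `η` with probability at
most `δ`: no sub-`r` velocity-law mixture structure of `O(1)` strength before the first shock (cards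
`kinetic-slab-entropy-spending` (2B), `gaussian-branch-window-transfer` (2B); K1-strength). [conjecture] -/
theorem stub_scaleTransfer :
    ∃ η₀ : ℝ, 0 < η₀ ∧ ∀ (a₀ θ₀ : T3 → ℝ) (u₀ : T3 → V3), Continuous a₀ → Continuous θ₀ → Continuous u₀ →
    (∀ x, 0 < a₀ x) → (∀ x, 0 < θ₀ x) → ∃ σ₀ : ℝ, 0 < σ₀ ∧ ∀ σ : ℝ, 0 < σ → σ < σ₀ →
    ∀ (T : ℝ) (ρ θ : ℝ → T3 → ℝ) (u : ℝ → T3 → V3), IsHardSphereEulerSolution σ T ρ u θ →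
    ∀ Φ : (N : ℕ) → HardSphereFlow (Torus.geometry (Fin 3)) (hsDiameter σ N) (N + 1),
    TendstoHydroFieldsAt (fun N => localGibbsLaw σ a₀ u₀ θ₀ N (Φ N)) Φ ρ u θ 0 →
    ∀ τ : ℝ, 0 < τ → τ < T → ∀ χ : ℝ × UnitAddTorus (Fin 3) → ℝ, Continuous χ →
    ∀ g : ℝ → ℝ, Continuous g → (∀ a, η₀ ≤ a → g a = 0) →
    ∀ Ψ : V3 × V3 × V3 → ℝ, Continuous Ψ → (∃ C : ℝ, ∀ q, |Ψ q| ≤ C) →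
    (∀ (n v w : V3), ‖n‖ = 1 → Ψ (-n, (reflectVel n (v, w)).1, (reflectVel n (v, w)).2) = -Ψ (n, v, w)) →
    ∀ η δ : ℝ, 0 < η → 0 < δ → ∃ r₀ : ℝ, 0 < r₀ ∧ ∀ r ϑ : ℝ, 0 < r → r < r₀ → 0 < ϑ → ϑ < r₀ →
    ∃ K₀ : ℕ, ∀ K : ℕ, K₀ ≤ K → ∃ N₀ : ℕ, ∀ N : ℕ, N₀ ≤ N →
      localGibbsLaw σ a₀ u₀ θ₀ N (Φ N)
        {z | η < |metroOddStat σ N (Φ N) τ χ g Ψ r ϑ z -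
            metroOddStat σ N (Φ N) τ χ g Ψ
              ((K : ℝ) ^ (1 / 4 : ℝ) * ((N + 1 : ℕ) : ℝ) ^ (-(1 / 3 : ℝ))) ϑ z|}
        ≤ ENNReal.ofReal δ := by
  sorry

/-! ## Composition, step 1: the full-window equilibrium rate from the slab bet -/

/-- **`windowRate`** — the full-window equilibrium large-deviation bound at the kinetic mesoscale: under
`G_N = localGibbsLaw σ 1 0 θe`, for every deviation `x > 0` and rate `M > 0`, for `K ≥ K₀(x, M, …)` and all
large `N`, `G_N{x < |D_{r_K}|} ≤ e^{-M(N+1)}`, `D_{r_K}` the crux statistic read at `r_K = K^{1/4}(N+1)^{-1/3}`.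
From S1 (slab pressure at tilt `2M/x · 2στ`, level `x/(4στ)`), S2 (the window `[0, τ]` is `W = ⌈τ/(K t_N)⌉`
shifted slabs of length `τ/W ∈ [K t_N/2, K t_N]`), S3/S3b (measurability), S4 (Hölder over the `G_N`-preserving
shifts `Φ_{wℓ}` + Chernoff) and S5 (closed versus half-open window). [folklore] -/
theorem windowRate :
    ∃ η₀ : ℝ, 0 < η₀ ∧ ∀ θe : ℝ, 0 < θe → ∃ σ₀ : ℝ, 0 < σ₀ ∧ ∀ σ : ℝ, 0 < σ → σ < σ₀ →
    ∀ Φ : (N : ℕ) → HardSphereFlow (Torus.geometry (Fin 3)) (hsDiameter σ N) (N + 1),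
    ∀ τ : ℝ, 0 < τ → ∀ χ : ℝ × UnitAddTorus (Fin 3) → ℝ, Continuous χ →
    ∀ g : ℝ → ℝ, Continuous g → (∀ a, η₀ ≤ a → g a = 0) →
    ∀ Ψ : V3 × V3 × V3 → ℝ, Continuous Ψ → (∃ C : ℝ, ∀ q, |Ψ q| ≤ C) →
    (∀ (n v w : V3), ‖n‖ = 1 → Ψ (-n, (reflectVel n (v, w)).1, (reflectVel n (v, w)).2) = -Ψ (n, v, w)) →
    ∀ ϑ : ℝ, 0 < ϑ → ∀ x M : ℝ, 0 < x → 0 < M →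
    ∃ K₀ : ℕ, ∀ K : ℕ, K₀ ≤ K → ∃ N₀ : ℕ, ∀ N : ℕ, N₀ ≤ N →
      localGibbsLaw σ (fun _ => 1) (fun _ => 0) (fun _ => θe) N (Φ N)
        {z | x < |metroOddStat σ N (Φ N) τ χ g Ψ
            ((K : ℝ) ^ (1 / 4 : ℝ) * ((N + 1 : ℕ) : ℝ) ^ (-(1 / 3 : ℝ))) ϑ z|}
        ≤ ENNReal.ofReal (Real.exp (-(M * ((N : ℝ) + 1)))) := by
  obtain ⟨η₀, hη₀, hS1⟩ := slabPressure
  refine ⟨η₀, hη₀, fun θe hθe => ?_⟩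
  obtain ⟨σ₁, hσ₁, hS1'⟩ := hS1 θe hθe
  refine ⟨min σ₁ 4⁻¹, lt_min hσ₁ (by norm_num), ?_⟩
  intro σ hσ hσlt Φ τ hτ χ hχ g hg hg0 Ψ hΨ hΨb hΨodd ϑ hϑ x M hx hM
  have hσ₁' : σ < σ₁ := hσlt.trans_le (min_le_left _ _)
  have hσ4 : σ < 4⁻¹ := hσlt.trans_le (min_le_right _ _)
  have hσ2 : σ < 2⁻¹ := hσ4.trans (by norm_num)
  -- constants: per-particle tilt `b`, slab tilt band top `bb`, level `y`
  set b : ℝ := 2 * M / x with hb_def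
  have hb : 0 < b := by positivity
  set bb : ℝ := 2 * b * σ * τ with hbb_def
  have hbb : 0 < bb := by positivity
  set y : ℝ := x / (4 * σ * τ) with hy_def
  have hy : 0 < y := by positivity
  obtain ⟨K₀, hK₀⟩ := hS1' σ hσ hσ₁' Φ τ hτ χ hχ g hg hg0 Ψ hΨ hΨb hΨodd ϑ hϑ bb y hbb hy
  refine ⟨max K₀ 1, fun K hK => ?_⟩
  have hK0 : K₀ ≤ K := (le_max_left _ _).trans hK
  have hK1 : 1 ≤ K := (le_max_right _ _).trans hK
  have hKpos : (0 : ℝ) < K := by exact_mod_cast hK1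
  obtain ⟨N₀, hN₀⟩ := hK₀ K hK0
  -- `K t_N ≤ τ` eventually
  obtain ⟨N₁, hN₁⟩ : ∃ N₁ : ℕ, ∀ N : ℕ, N₁ ≤ N →
      (K : ℝ) * ((N + 1 : ℕ) : ℝ) ^ (-(1 / 3 : ℝ)) ≤ τ := by
    have h1 : Tendsto (fun N : ℕ => ((N + 1 : ℕ) : ℝ)) atTop atTop :=
      tendsto_natCast_atTop_atTop.comp (tendsto_add_atTop_nat 1)
    have h2 : Tendsto (fun N : ℕ => ((N + 1 : ℕ) : ℝ) ^ (-(1 / 3 : ℝ))) atTop (𝓝 0) :=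
      (tendsto_rpow_neg_atTop (by norm_num : (0 : ℝ) < 1 / 3)).comp h1
    have h3 : Tendsto (fun N : ℕ => (K : ℝ) * ((N + 1 : ℕ) : ℝ) ^ (-(1 / 3 : ℝ))) atTop (𝓝 0) := by
      simpa using h2.const_mul (K : ℝ)
    obtain ⟨N₁, hN₁⟩ := eventually_atTop.1 (h3.eventually (Iic_mem_nhds hτ))
    exact ⟨N₁, fun N hN => hN₁ N hN⟩
  refine ⟨max N₀ N₁, fun N hN => ?_⟩
  have hN₀' : N₀ ≤ N := (le_max_left _ _).trans hN
  have hN₁' : N₁ ≤ N := (le_max_right _ _).trans hN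
  -- notation
  set tN : ℝ := ((N + 1 : ℕ) : ℝ) ^ (-(1 / 3 : ℝ)) with htN_def
  set rKN : ℝ := (K : ℝ) ^ (1 / 4 : ℝ) * tN with hrKN_def
  set ε : ℝ := hsDiameter σ N with hε_def
  have hε : ε = σ * tN := rfl
  have htN : 0 < tN := Real.rpow_pos_of_pos (by positivity) _
  have hε0 : 0 < ε := hsDiameter_pos hσ N
  have hε2 : ε < 2⁻¹ := (hsDiameter_le hσ.le N).trans_lt hσ2
  have hrKN : 0 < rKN := mul_pos (Real.rpow_pos_of_pos hKpos _) htN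
  have hN1 : (0 : ℝ) < (N : ℝ) + 1 := by positivity
  have hKt : 0 < (K : ℝ) * tN := mul_pos hKpos htN
  have hKtτ : (K : ℝ) * tN ≤ τ := hN₁ N hN₁'
  set G := localGibbsLaw σ (fun _ => 1) (fun _ => 0) (fun _ => θe) N (Φ N) with hG_def
  haveI : IsProbabilityMeasure G :=
    isProbabilityMeasure_localGibbsLaw continuous_const continuous_const continuous_const
      (fun _ => one_pos) (fun _ => hθe) (by linarith : σ ≤ 1 / 2) N (Φ N)
  -- the slabs: `W = ⌈τ/(K t_N)⌉` of length `ℓ = τ/W ∈ [K t_N/2, K t_N]`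
  set W : ℕ := ⌈τ / ((K : ℝ) * tN)⌉₊ with hW_def
  have hWpos : 0 < W := Nat.ceil_pos.2 (div_pos hτ hKt)
  have hW0 : (0 : ℝ) < W := by exact_mod_cast hWpos
  set ℓ : ℝ := τ / W with hℓ_def
  have hℓ0 : 0 ≤ ℓ := by positivity
  have hWℓ : (W : ℝ) * ℓ = τ := by rw [hℓ_def]; field_simp
  have hWge : τ ≤ (W : ℝ) * ((K : ℝ) * tN) := by
    have := Nat.le_ceil (τ / ((K : ℝ) * tN))
    rwa [div_le_iff₀ hKt] at this
  have hWle : (W : ℝ) * ((K : ℝ) * tN) ≤ 2 * τ := by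
    have h1 : (W : ℝ) < τ / ((K : ℝ) * tN) + 1 := Nat.ceil_lt_add_one (by positivity)
    have h2 : (W : ℝ) * ((K : ℝ) * tN) < τ + (K : ℝ) * tN := by
      have := mul_lt_mul_of_pos_right h1 hKt
      rwa [add_mul, one_mul, div_mul_cancel₀ _ hKt.ne'] at this
    linarith
  have hℓ_le : ℓ ≤ (K : ℝ) * tN := by
    rw [hℓ_def, div_le_iff₀ hW0]; linarith
  have hℓ_ge : (K : ℝ) * tN / 2 ≤ ℓ := by
    rw [hℓ_def, le_div_iff₀ hW0]; linarith
  -- the slab functionals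
  set χw : ℕ → ℝ × UnitAddTorus (Fin 3) → ℝ := fun w p => χ (p.1 + (w : ℝ) * ℓ, p.2) with hχw_def
  have hχw : ∀ w, Continuous (χw w) := fun w => hχ.comp (by fun_prop)
  set Sw : ℕ → Config (N + 1) (Fin 3) T3 → ℝ := fun w z =>
    metroOddSum σ N (Φ N) (Set.Ioc 0 ℓ) (χw w) g Ψ rKN ϑ z with hSw_def
  set f : ℕ → Config (N + 1) (Fin 3) T3 → ℝ := fun w z => b * ε * Sw w z with hf_def
  set T : ℕ → Config (N + 1) (Fin 3) T3 → Config (N + 1) (Fin 3) T3 := fun w => (Φ N).flow ((w : ℝ) * ℓ)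
    with hT_def
  set gm : ℝ → Config (N + 1) (Fin 3) T3 → Fin (N + 1) → Fin (N + 1) → ℝ :=
    fun t z' i j => metroOddMark σ N χ g Ψ rKN ϑ t z' i j with hgm_def
  -- Step A: decomposition of the statistic on the complement of a null set
  set Z : Set (Config (N + 1) (Fin 3) T3) :=
    {z | (0 : ℝ) ∈ collisionTimes (Torus.geometry (Fin 3)) (hsDiameter σ N) (fun t => (Φ N).flow t z)} ∪
      (Φ N).goodᶜ with hZ_def
  have hZ : G Z = 0 := stub_timeZeroNull hσ _ _ _ N (Φ N)
  have hdecomp : ∀ z, z ∉ Z → metroOddStat σ N (Φ N) τ χ g Ψ rKN ϑ z =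
      ε / (N + 1 : ℝ) * ∑ w ∈ Finset.range W, Sw w (T w z) := by
    intro z hz
    have hzg : z ∈ (Φ N).good := by
      by_contra h; exact hz (Or.inr h)
    have hz0 : (0 : ℝ) ∉ collisionTimes (Torus.geometry (Fin 3)) (hsDiameter σ N)
        (fun t => (Φ N).flow t z) := fun h => hz (Or.inl h)
    obtain ⟨hshift, hadd, hclosed⟩ := stub_slabShiftDecomp (Φ N) gm hzg
    rw [metroOddStat_eq, metroOddSum_eq_collisionPairSum_of_mem_good _ _ hzg]
    change ε / (N + 1 : ℝ) * (Φ N).collisionPairSum (Set.Icc 0 τ) gm z = _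
    rw [hclosed hz0 τ, show Set.Ioc (0 : ℝ) τ = Set.Ioc 0 ((W : ℝ) * ℓ) by rw [hWℓ], hadd ℓ hℓ0 W]
    congr 1
    refine Finset.sum_congr rfl fun w _ => ?_
    have hTz : T w z ∈ (Φ N).good := (Φ N).mapsTo_good _ hzg
    rw [show Set.Ioc ((w : ℝ) * ℓ) (((w : ℝ) + 1) * ℓ) = Set.Ioc ((w : ℝ) * ℓ + 0) ((w : ℝ) * ℓ + ℓ) by
      congr 1 <;> ring, hshift ((w : ℝ) * ℓ) 0 ℓ, hSw_def]
    simp only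
    rw [metroOddSum_eq_collisionPairSum_of_mem_good _ _ hTz]
    rfl
  -- Step B: the event inclusion
  set c : ℝ := b * ((N : ℝ) + 1) * x with hc_def
  have hεN : 0 < ε / (N + 1 : ℝ) := div_pos hε0 hN1
  have hsub : {z | x < |metroOddStat σ N (Φ N) τ χ g Ψ rKN ϑ z|} ⊆
      Z ∪ {z | c ≤ ∑ w ∈ Finset.range W, |f w (T w z)|} := by
    intro z hz
    by_cases hzZ : z ∈ Z
    · exact Or.inl hzZ
    right
    simp only [mem_setOf_eq] at hz ⊢
    rw [hdecomp z hzZ] at hz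
    have h1 : x < ε / (N + 1 : ℝ) * ∑ w ∈ Finset.range W, |Sw w (T w z)| := by
      calc x < |ε / (N + 1 : ℝ) * ∑ w ∈ Finset.range W, Sw w (T w z)| := hz
        _ = ε / (N + 1 : ℝ) * |∑ w ∈ Finset.range W, Sw w (T w z)| := by
            rw [abs_mul, abs_of_pos hεN]
        _ ≤ ε / (N + 1 : ℝ) * ∑ w ∈ Finset.range W, |Sw w (T w z)| :=
            mul_le_mul_of_nonneg_left (Finset.abs_sum_le_sum_abs _ _) hεN.le
    have h2 : ∑ w ∈ Finset.range W, |f w (T w z)| = b * ε * ∑ w ∈ Finset.range W, |Sw w (T w z)| := by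
      rw [Finset.mul_sum]
      refine Finset.sum_congr rfl fun w _ => ?_
      rw [hf_def]
      simp only
      rw [abs_mul, abs_of_pos (mul_pos hb hε0)]
    rw [h2, hc_def]
    have h3 : ((N : ℝ) + 1) * x ≤ ε * ∑ w ∈ Finset.range W, |Sw w (T w z)| := by
      have h1' := h1
      rw [div_mul_eq_mul_div, lt_div_iff₀ hN1] at h1'
      linarith
    calc b * ((N : ℝ) + 1) * x = b * (((N : ℝ) + 1) * x) := by ring
      _ ≤ b * (ε * ∑ w ∈ Finset.range W, |Sw w (T w z)|) := mul_le_mul_of_nonneg_left h3 hb.le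
      _ = b * ε * ∑ w ∈ Finset.range W, |Sw w (T w z)| := by ring
  -- Step C: Hölder over the `G`-preserving shifts + Chernoff
  have hT : ∀ w < W, MeasurePreserving (T w) G G := fun w _ =>
    measurePreserving_flow_localGibbsLaw_const σ 1 θe 0 N (Φ N) _
  have hgood : ∀ᵐ z ∂G, z ∈ (Φ N).good := by
    have : G (Φ N).goodᶜ = 0 := measure_mono_null subset_union_right hZ
    exact mem_ae_iff.2 this
  have hfm : ∀ w < W, AEMeasurable (f w) G := by
    intro w _
    obtain ⟨hcont, hmeas⟩ := stub_metroMarkRegular hσ hσ2 N (hχw w) hg hΨ hrKN hϑ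
    obtain ⟨hIoc, -⟩ := stub_collisionPairSumMeasurable hε0 hε2 (Φ N)
      (fun t z' i j => metroOddMark σ N (χw w) g Ψ rKN ϑ t z' i j) hcont hmeas 0 ℓ
    have hae : Sw w =ᵐ[G] (Φ N).good.indicator ((Φ N).collisionPairSum (Set.Ioc 0 ℓ)
        (fun t z' i j => metroOddMark σ N (χw w) g Ψ rKN ϑ t z' i j)) := by
      filter_upwards [hgood] with z hz
      rw [indicator_of_mem hz, hSw_def]
      exact metroOddSum_eq_collisionPairSum_of_mem_good _ _ hz
    have h1 : AEMeasurable (Sw w) G := hIoc.aemeasurable.congr hae.symm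
    exact h1.const_mul (b * ε)
  set b₁ : ℝ := (W : ℝ) * (b * ε) * K with hb₁_def
  have hb₁ : b₁ = b * σ * ((W : ℝ) * ((K : ℝ) * tN)) := by rw [hb₁_def, hε]; ring
  have hb₁lo : bb / 2 ≤ b₁ := by
    rw [hb₁, hbb_def]
    have : b * σ * τ ≤ b * σ * ((W : ℝ) * ((K : ℝ) * tN)) :=
      mul_le_mul_of_nonneg_left hWge (by positivity)
    linarith
  have hb₁hi : b₁ ≤ bb := by
    rw [hb₁, hbb_def]
    have : b * σ * ((W : ℝ) * ((K : ℝ) * tN)) ≤ b * σ * (2 * τ) :=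
      mul_le_mul_of_nonneg_left hWle (by positivity)
    linarith
  set B : ℝ := b₁ * y * ((N : ℝ) + 1) with hB_def
  have hexp : ∀ w < W, ∫⁻ z, ENNReal.ofReal (Real.exp ((W : ℝ) * |f w z|)) ∂G ≤
      ENNReal.ofReal (Real.exp B) := by
    intro w hw
    have hs : (w : ℝ) * ℓ ∈ Set.Icc (0 : ℝ) τ := by
      refine ⟨by positivity, ?_⟩
      have hwW : (w : ℝ) ≤ W := by exact_mod_cast (Finset.mem_range.1 (Finset.mem_range.2 hw)).le
      calc (w : ℝ) * ℓ ≤ (W : ℝ) * ℓ := mul_le_mul_of_nonneg_right hwW hℓ0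
        _ = τ := hWℓ
    have key := hN₀ N hN₀' ((w : ℝ) * ℓ) hs ℓ hℓ_ge hℓ_le b₁ hb₁lo hb₁hi
    refine le_of_eq_of_le (lintegral_congr fun z => ?_) key
    have hz : (W : ℝ) * |f w z| = b₁ / K *
        |metroOddSum σ N (Φ N) (Set.Ioc 0 ℓ) (fun p => χ (p.1 + (w : ℝ) * ℓ, p.2)) g Ψ
          ((K : ℝ) ^ (1 / 4 : ℝ) * ((N + 1 : ℕ) : ℝ) ^ (-(1 / 3 : ℝ))) ϑ z| := by
      rw [hf_def, hSw_def, hχw_def, hrKN_def, htN_def]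
      simp only
      rw [abs_mul, abs_of_pos (mul_pos hb hε0), hb₁_def]
      field_simp
    rw [hz]
  have hHC := stub_hoelderChernoff G hWpos T hT f hfm hexp c
  -- Step D: the exponent
  have hBc : B - c ≤ -(M * ((N : ℝ) + 1)) := by
    have h1 : B ≤ bb * y * ((N : ℝ) + 1) := by
      rw [hB_def]
      exact mul_le_mul_of_nonneg_right (mul_le_mul_of_nonneg_right hb₁hi hy.le) hN1.le
    have h2 : bb * y = b * x / 2 := by
      rw [hbb_def, hy_def]; field_simp; ring
    have h3 : b * x = 2 * M := by rw [hb_def]; field_simp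
    rw [h2] at h1
    rw [hc_def]
    nlinarith
  calc G {z | x < |metroOddStat σ N (Φ N) τ χ g Ψ rKN ϑ z|}
      ≤ G (Z ∪ {z | c ≤ ∑ w ∈ Finset.range W, |f w (T w z)|}) := measure_mono hsub
    _ ≤ G Z + G {z | c ≤ ∑ w ∈ Finset.range W, |f w (T w z)|} := measure_union_le _ _
    _ ≤ 0 + ENNReal.ofReal (Real.exp (B - c)) := add_le_add hZ.le hHC
    _ ≤ ENNReal.ofReal (Real.exp (-(M * ((N : ℝ) + 1)))) := by
        rw [zero_add]
        exact ENNReal.ofReal_le_ofReal (Real.exp_le_exp.2 hBc)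

/-! ## Composition, step 2: the crux -/

/-- **The crux `OddContactSymmetry` from the line's stubs** (`windowRate` ⇐ S1–S5, the PROVED
`TransferInequality`, and S6): with `η₀ = min η₀^{S1} η₀^{S6}`, `θe = 1 + sup θ₀`, `σ₀` the minimum of the three
thresholds, and for given `η, δ`: `r₀` from S6 at `(η/2, δ/2)`; `K` large for S6 and for `windowRate` at
`x = η/2`, `M = |C| + 1` (`C` the transfer constant); then
`LG{η < |D_r|} ≤ LG{η/2 < |D_{r_K}|} + LG{η/2 < |D_r − D_{r_K}|} ≤ e^{(C − M)(N+1)/2} + δ/2 ≤ δ`. [folklore] -/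
theorem OddContactSymmetry_of : OddContactSymmetry := by
  rw [oddContactSymmetry_iff_metroOddStat]
  obtain ⟨η₁, hη₁, hW⟩ := windowRate
  obtain ⟨η₂, hη₂, hS⟩ := stub_scaleTransfer
  refine ⟨min η₁ η₂, lt_min hη₁ hη₂, ?_⟩
  intro a₀ θ₀ u₀ ha hθ hu ha0 hθ0
  -- a reference temperature dominating `θ₀` (compact torus)
  obtain ⟨Cθ, hCθ⟩ :=
    (isCompact_univ (X := UnitAddTorus (Fin 3))).exists_bound_of_continuousOn hθ.continuousOn
  set θe : ℝ := |Cθ| + 1 with hθe_def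
  have hθe : 0 < θe := by positivity
  have h2θe : ∀ x, θ₀ x < 2 * θe := by
    intro x
    have h1 : θ₀ x ≤ |Cθ| := by
      have := hCθ x (mem_univ x)
      rw [Real.norm_eq_abs] at this
      exact (le_abs_self _).trans (this.trans (le_abs_self _))
    rw [hθe_def]
    linarith [abs_nonneg Cθ]
  obtain ⟨σ₁, hσ₁, hTI⟩ := transferInequality_proof a₀ θ₀ u₀ ha hθ hu ha0 hθ0 θe h2θe
  obtain ⟨σ₂, hσ₂, hWR⟩ := hW θe hθe
  obtain ⟨σ₃, hσ₃, hST⟩ := hS a₀ θ₀ u₀ ha hθ hu ha0 hθ0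
  refine ⟨min (min σ₁ σ₂) σ₃, lt_min (lt_min hσ₁ hσ₂) hσ₃, ?_⟩
  intro σ hσ hσlt T ρ θ u hsol Φ hLLN τ hτ hτT χ hχ g hg hg0 Ψ hΨ hΨb hΨodd η δ hη hδ
  have hσ₁' : σ < σ₁ := hσlt.trans_le ((min_le_left _ _).trans (min_le_left _ _))
  have hσ₂' : σ < σ₂ := hσlt.trans_le ((min_le_left _ _).trans (min_le_right _ _))
  have hσ₃' : σ < σ₃ := hσlt.trans_le (min_le_right _ _)
  have hg₁ : ∀ a, η₁ ≤ a → g a = 0 := fun a ha' => hg0 a ((min_le_left _ _).trans ha')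
  have hg₂ : ∀ a, η₂ ≤ a → g a = 0 := fun a ha' => hg0 a ((min_le_right _ _).trans ha')
  obtain ⟨C, hC⟩ := hTI σ hσ hσ₁'
  have hη2 : 0 < η / 2 := by positivity
  have hδ2 : 0 < δ / 2 := by positivity
  obtain ⟨r₀, hr₀, hr⟩ := hST σ hσ hσ₃' T ρ θ u hsol Φ hLLN τ hτ hτT χ hχ g hg hg₂ Ψ hΨ hΨb hΨodd
    (η / 2) (δ / 2) hη2 hδ2
  refine ⟨r₀, hr₀, ?_⟩
  intro r ϑ hr0 hrr hϑ0 hϑr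
  obtain ⟨K₁, hK₁⟩ := hr r ϑ hr0 hrr hϑ0 hϑr
  set M : ℝ := |C| + 1 with hM_def
  have hM : 0 < M := by positivity
  obtain ⟨K₂, hK₂⟩ := hWR σ hσ hσ₂' Φ τ hτ χ hχ g hg hg₁ Ψ hΨ hΨb hΨodd ϑ hϑ0 (η / 2) M hη2 hM
  obtain ⟨N₁, hN₁⟩ := hK₁ (max K₁ K₂) (le_max_left _ _)
  obtain ⟨N₂, hN₂⟩ := hK₂ (max K₁ K₂) (le_max_right _ _)
  -- `exp (-(N+1)/2) ≤ δ/2` eventually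
  obtain ⟨N₃, hN₃⟩ : ∃ N₃ : ℕ, ∀ N : ℕ, N₃ ≤ N → Real.exp (-((N : ℝ) + 1) / 2) ≤ δ / 2 := by
    have ht : Tendsto (fun N : ℕ => Real.exp (-((N : ℝ) + 1) / 2)) atTop (𝓝 0) := by
      refine Real.tendsto_exp_atBot.comp ?_
      have h1 : Tendsto (fun N : ℕ => (N : ℝ) + 1) atTop atTop :=
        tendsto_natCast_atTop_atTop.atTop_add tendsto_const_nhds
      have h2 : Tendsto (fun N : ℕ => -((N : ℝ) + 1)) atTop atBot := tendsto_neg_atTop_atBot.comp h1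
      simpa [neg_div] using h2.atBot_div_const (by norm_num : (0 : ℝ) < 2)
    obtain ⟨N₃, hN₃⟩ := eventually_atTop.1 (ht.eventually (Iic_mem_nhds hδ2))
    exact ⟨N₃, fun N hN => hN₃ N hN⟩
  refine ⟨max (max N₁ N₂) N₃, fun N hN => ?_⟩
  have hN₁' : N₁ ≤ N := ((le_max_left _ _).trans (le_max_left _ _)).trans hN
  have hN₂' : N₂ ≤ N := ((le_max_right _ _).trans (le_max_left _ _)).trans hN
  have hN₃' : N₃ ≤ N := (le_max_right _ _).trans hN
  set K : ℕ := max K₁ K₂ with hK_def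
  set P := localGibbsLaw σ a₀ u₀ θ₀ N (Φ N) with hP_def
  set D : Config (N + 1) (Fin 3) T3 → ℝ := fun z => metroOddStat σ N (Φ N) τ χ g Ψ r ϑ z with hD_def
  set D' : Config (N + 1) (Fin 3) T3 → ℝ := fun z => metroOddStat σ N (Φ N) τ χ g Ψ
    ((K : ℝ) ^ (1 / 4 : ℝ) * ((N + 1 : ℕ) : ℝ) ^ (-(1 / 3 : ℝ))) ϑ z with hD'_def
  -- the mesoscale event, transferred from the invariant Gibbs law
  have hA : P {z | η / 2 < |D' z|} ≤ ENNReal.ofReal (δ / 2) := by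
    have h1 := hC N (Φ N) {z | η / 2 < |D' z|}
    have h2 := hN₂ N hN₂'
    have hN0 : (0 : ℝ) ≤ (N : ℝ) + 1 := by positivity
    have hCM : (C - M) * ((N : ℝ) + 1) ≤ -((N : ℝ) + 1) := by
      have : C - M ≤ -1 := by rw [hM_def]; linarith [le_abs_self C]
      nlinarith
    have h3 : P {z | η / 2 < |D' z|} ^ 2 ≤ ENNReal.ofReal (Real.exp (-((N : ℝ) + 1) / 2)) ^ 2 := by
      calc P {z | η / 2 < |D' z|} ^ 2
          ≤ ENNReal.ofReal (Real.exp (C * (N + 1))) *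
              ENNReal.ofReal (Real.exp (-(M * ((N : ℝ) + 1)))) := h1.trans (by gcongr)
        _ = ENNReal.ofReal (Real.exp ((C - M) * ((N : ℝ) + 1))) := by
            rw [← ENNReal.ofReal_mul (Real.exp_pos _).le, ← Real.exp_add]
            congr 1; congr 1; ring
        _ ≤ ENNReal.ofReal (Real.exp (-((N : ℝ) + 1))) :=
            ENNReal.ofReal_le_ofReal (Real.exp_le_exp.2 hCM)
        _ = ENNReal.ofReal (Real.exp (-((N : ℝ) + 1) / 2)) ^ 2 := by
            rw [← ENNReal.ofReal_pow (Real.exp_pos _).le, ← Real.exp_nat_mul]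
            congr 1; congr 1; push_cast; ring
    exact ((ENNReal.pow_le_pow_left_iff two_ne_zero).1 h3).trans
      (ENNReal.ofReal_le_ofReal (hN₃ N hN₃'))
  -- the two-scale event, from (2B)
  have hB : P {z | η / 2 < |D z - D' z|} ≤ ENNReal.ofReal (δ / 2) := hN₁ N hN₁'
  have hsub : {z | η < |D z|} ⊆ {z | η / 2 < |D' z|} ∪ {z | η / 2 < |D z - D' z|} := by
    intro z hz
    simp only [mem_setOf_eq, mem_union] at hz ⊢
    by_contra hcon
    push Not at hcon
    have := abs_sub_abs_le_abs_sub (D z) (D' z)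
    linarith [hcon.1, hcon.2]
  calc P {z | η < |D z|}
      ≤ P ({z | η / 2 < |D' z|} ∪ {z | η / 2 < |D z - D' z|}) := measure_mono hsub
    _ ≤ P {z | η / 2 < |D' z|} + P {z | η / 2 < |D z - D' z|} := measure_union_le _ _
    _ ≤ ENNReal.ofReal (δ / 2) + ENNReal.ofReal (δ / 2) := add_le_add hA hB
    _ = ENNReal.ofReal δ := by rw [← ENNReal.ofReal_add hδ2.le hδ2.le, add_halves]

end Summit.AtomisticToContinuum.HydrodynamicLimit.Theorems.OddContactSymmetryKineticSlab

end
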